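import Mathlib
import HarnessLib
import Literature.Computability.AlgebraicComplexity.PatternExpressions
import Literature.Computability.AlgebraicComplexity.DiPatternExpressions
import Literature.Combinatorics.SimpleGraph.TreeDecomposition
import Summits.ValiantsHypothesis.ValiantsHypothesis.Theorems.MonotoneRestorationOrbitCompressionQPTwoSortedPassageSparse
import Summits.ValiantsHypothesis.ValiantsHypothesis.Theorems.MonotoneRestorationOrbitRestorationLinearVolumeQPHomPolyBasics
import Summits.ValiantsHypothesis.ValiantsHypothesis.Theorems.MonotoneRestorationOrbitRestorationLinearVolumeQPSubThresholdDescentExchange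

/-!
# Route MonotoneRestoration — aside `OrbitRestorationLinearVolumeQP` (stmt-ValiantsHypothesis-18294):
# SUB-THRESHOLD DESCENT, addendum — the VERTEX-BUDGET passage transfers the width EXACTLY

`Theorems/…OrbitCompressionQPTwoSortedPassage.lean` (`TwoSortedPassage.mem_narrowSpan_of_mem_span_diHom`) transfers a
ONE-SORTED vertex budget to a BIPARTITE treewidth bound: a matrix-symmetric `p` in the span of the `dihom_{D,n}` with `D`
on `≤ m` vertices lies in the bipartite span of treewidth `≤ 2m - 1` — the width of the one-sorted patterns is lost.
With the exchange lemma (`SubThresholdDescent.descent_of_expansions`) the width is KEPT, provided the budget is at most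
half the order:

* `descent_of_vertexBudget` — **for `2m ≤ n`, a matrix-symmetric `p` in the span of the `dihom_{D,n}` over one-sorted
  patterns `D` on `≤ m` vertices AND of treewidth `≤ w` lies in the span of the `hom_{F,n}` over bipartite patterns of
  treewidth `≤ w`** — any degree, any number of terms, any edge multiplicities (no degree hypothesis: the monomials of
  such a `p` use `≤ m` rows and `≤ m` columns, `TwoSortedPassage.rows_cols_le_of_mem_span_diHom`, so the refined spanning
  theorem `TwoSortedPassage.mem_span_homPoly_of_rows_cols_le` supplies a bipartite expansion over patterns with `≤ m` rows
  and `≤ m` columns, whose orientations fit into `n` vertices).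

So in the row/column-sparsity regime (the scope of `…TwoSortedPassageSparse.lean`) the one-sorted → two-sorted passage is
exact in the width as well.  Honest label: structural (VH-free) helper for the residue between line `birth` and the crux;
the stub `stub_lvNarrowSpan`, R1 and VP ≠ VNP are NOT moved.  Def-free (`--supports stmt-ValiantsHypothesis-18294`);
nothing here is a named fact.

References: Dawar–Pago–Seppelt 2025 (arXiv:2502.06740) Remark p. 17, §7 p. 45; Dwivedi–Pago–Seppelt 2026
(arXiv:2601.09343) §8.
-/

noncomputable section

open scoped Classical

-- `Summit.ValiantsHypothesis.ValiantsHypothesis.…` is the tree's single-conjunct layout (Sub = Summit).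
set_option linter.dupNamespace false

namespace Summit.ValiantsHypothesis.ValiantsHypothesis.Theorems.SubThresholdDescent

open Literature.Computability.AlgebraicComplexity MvPolynomial
open Literature.Combinatorics.SimpleGraph (treewidth treewidth_le_of_hom_injective)
open Summit.ValiantsHypothesis.ValiantsHypothesis.Theorems

/-- **THE VERTEX-BUDGET PASSAGE WITH EXACT WIDTH.**  Let `2m ≤ n` and let `p` be a MATRIX-symmetric polynomial on
the `n × n` matrix lying in the span of the one-sorted homomorphism polynomials `dihom_{D,n}` of directed looped
patterns `D` on `≤ m` vertices and of treewidth `≤ w`.  Then `p` lies in the span of the bipartite homomorphism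
polynomials `hom_{F,n}` of patterns of treewidth `≤ w` (sharpening `TwoSortedPassage.mem_narrowSpan_of_mem_span_diHom`,
whose conclusion is treewidth `≤ 2m - 1`). [folklore] -/
theorem descent_of_vertexBudget (n m w : ℕ) (hm : 2 * m ≤ n) (p : MvPolynomial (Fin n × Fin n) ℂ)
    (hp : ∀ σ τ : Equiv.Perm (Fin n), rename (fun ij : Fin n × Fin n => (σ ij.1, τ ij.2)) p = p)
    (hmem : p ∈ Submodule.span ℂ {q : MvPolynomial (Fin n × Fin n) ℂ |
      ∃ (a : ℕ) (D : Multiset (Fin a × Fin a)), a ≤ m ∧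
        treewidth (SimpleGraph.fromRel fun u v : Fin a => ∃ e ∈ D, u = e.1 ∧ v = e.2) ≤ w ∧
          q = diHomPoly D n ℂ}) :
    p ∈ Submodule.span ℂ {q : MvPolynomial (Fin n × Fin n) ℂ | ∃ (a b : ℕ) (F : Multiset (Fin a × Fin b)),
      treewidth (SimpleGraph.fromRel fun u v : Fin a ⊕ Fin b =>
          ∃ e ∈ F, u = Sum.inl e.1 ∧ v = Sum.inr e.2) ≤ w ∧
        q = homPoly F n ℂ} := by
  -- (1) the one-sorted expansion, isolated vertices erased, transported to `Fin`
  obtain ⟨m₁, α, q, hq⟩ := (Submodule.mem_span_set').1 hmem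
  choose a D ha hDtw hqD using fun i => (q i).2
  choose D' hD'map hD'vert hD'card using fun i => exists_eraseIsolated (D i)
  let cV : Fin m₁ → ℕ := fun i => Fintype.card {v // ∃ e ∈ D i, e.1 = v ∨ e.2 = v}
  let D'' : (i : Fin m₁) → Multiset (Fin (cV i) × Fin (cV i)) := fun i =>
    (D' i).map fun e => (Fintype.equivFin _ e.1, Fintype.equivFin _ e.2)
  have hD''poly : ∀ i, ∃ N : ℕ, diHomPoly (D i) n ℂ = N • diHomPoly (D'' i) n ℂ := by
    intro i
    refine ⟨n ^ Fintype.card {v // ¬ ∃ e ∈ D i, e.1 = v ∨ e.2 = v}, ?_⟩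
    rw [show diHomPoly (D'' i) n ℂ = diHomPoly (D' i) n ℂ from diHomPoly_map_equiv _ _ _,
      ← diHomPoly_map_subtype, hD'map]
  choose N hN using hD''poly
  have hD''tw : ∀ i, treewidth (SimpleGraph.fromRel fun u v : Fin (cV i) =>
      ∃ e ∈ D'' i, u = e.1 ∧ v = e.2) ≤ w := by
    intro i
    rw [show D'' i = (D' i).map (fun e => (Fintype.equivFin _ e.1, Fintype.equivFin _ e.2)) from rfl,
      treewidth_map_equiv]
    refine le_trans ?_ (hDtw i)
    have h := treewidth_le_of_map_injective (D' i) Subtype.val Subtype.val_injective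
    rwa [hD'map i] at h
  have hD''vert : ∀ i (u : Fin (cV i)), ∃ e ∈ D'' i, e.1 = u ∨ e.2 = u := by
    intro i u
    obtain ⟨e, he, hu⟩ := hD'vert i ((Fintype.equivFin _).symm u)
    refine ⟨_, Multiset.mem_map_of_mem _ he, ?_⟩
    rcases hu with hu | hu
    · exact Or.inl (by simp [hu])
    · exact Or.inr (by simp [hu])
  have hcV : ∀ i, cV i ≤ n := by
    intro i
    have h1 : cV i ≤ a i := (Fintype.card_subtype_le _).trans (Fintype.card_fin _).le
    have h2 := ha i
    omega
  have hpD : p = ∑ i, (α i * (N i : ℂ)) • diHomPoly (D'' i) n ℂ := by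
    rw [← hq]
    refine Finset.sum_congr rfl fun i _ => ?_
    rw [hqD i, hN i, mul_smul, Nat.cast_smul_eq_nsmul]
  -- (2) the monomials of `p` use `≤ m` rows and `≤ m` columns, so `p` has a bipartite expansion over patterns
  -- with `≤ m` rows and `≤ m` columns (three-budget spanning theorem); erase isolated vertices, transport
  have hdi : p ∈ Submodule.span ℂ {q : MvPolynomial (Fin n × Fin n) ℂ | ∃ (a : ℕ) (E : Multiset (Fin a × Fin a)),
      a ≤ m ∧ q = ∑ h : Fin a → Fin n,
        (E.map fun e => (X (h e.1, h e.2) : MvPolynomial (Fin n × Fin n) ℂ)).prod} := by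
    refine Submodule.span_mono ?_ hmem
    rintro q ⟨a, D, ha, -, rfl⟩
    exact ⟨a, D, ha, rfl⟩
  have hrows := fun M hM => (TwoSortedPassage.rows_cols_le_of_mem_span_diHom hdi M hM).1
  have hcols := fun M hM => (TwoSortedPassage.rows_cols_le_of_mem_span_diHom hdi M hM).2
  obtain ⟨m₂, γ, q₂, hq₂⟩ :=
    (Submodule.mem_span_set').1 (TwoSortedPassage.mem_span_homPoly_of_rows_cols_le p hp hrows hcols)
  choose a₂ b₂ F ha₂ hb₂ hF hqF using fun j => (q₂ j).2
  choose F' hF'map hF'row hF'col hF'card using fun j => exists_eraseIsolated₂ (F j)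
  let r : Fin m₂ → ℕ := fun j => Fintype.card {i // ∃ e ∈ F j, e.1 = i}
  let c : Fin m₂ → ℕ := fun j => Fintype.card {i // ∃ e ∈ F j, e.2 = i}
  let F'' : (j : Fin m₂) → Multiset (Fin (r j) × Fin (c j)) := fun j =>
    (F' j).map fun e => (Fintype.equivFin _ e.1, Fintype.equivFin _ e.2)
  have hF''poly : ∀ j, ∃ N : ℕ, homPoly (F j) n ℂ = N • homPoly (F'' j) n ℂ := by
    intro j
    refine ⟨n ^ Fintype.card {i // ¬ ∃ e ∈ F j, e.1 = i} * n ^ Fintype.card {i // ¬ ∃ e ∈ F j, e.2 = i},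
      ?_⟩
    rw [show homPoly (F'' j) n ℂ = homPoly (F' j) n ℂ from HomPolyBasics.homPoly_map_equiv _ _ _ _,
      ← homPoly_map_subtype, hF'map]
  choose N₂ hN₂ using hF''poly
  refine descent_of_expansions n w p cV D'' (fun i => α i * (N i : ℂ)) hcV hD''vert hD''tw hpD r c F''
    (fun j => γ j * (N₂ j : ℂ)) ?_ ?_ ?_ ?_
  · intro j
    have h1 : r j ≤ m := (Fintype.card_subtype_le _).trans (((Fintype.card_fin _).le).trans (ha₂ j))
    have h2 : c j ≤ m := (Fintype.card_subtype_le _).trans (((Fintype.card_fin _).le).trans (hb₂ j))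
    omega
  · intro j u
    obtain ⟨e, he, hu⟩ := hF'row j ((Fintype.equivFin _).symm u)
    exact ⟨_, Multiset.mem_map_of_mem _ he, by simp [hu]⟩
  · intro j v
    obtain ⟨e, he, hv⟩ := hF'col j ((Fintype.equivFin _).symm v)
    exact ⟨_, Multiset.mem_map_of_mem _ he, by simp [hv]⟩
  · rw [← hq₂]
    refine Finset.sum_congr rfl fun j _ => ?_
    rw [hqF j, hN₂ j, mul_smul, Nat.cast_smul_eq_nsmul]

/-- **Corollary in the shape of `TwoSortedPassage.mem_narrowSpan_of_mem_span_diHom`, sharpened**: for `2m ≤ n`, a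
matrix-symmetric polynomial in the span of the `dihom_{D,n}` over patterns on `≤ m` vertices lies in the bipartite
narrow span of treewidth `≤ m - 1` (instead of `2m - 1`): a pattern on `≤ m` vertices has treewidth `≤ m - 1`
(`treewidth_le_card_sub_one`). [folklore] -/
theorem mem_narrowSpan_of_mem_span_diHom_half (n m : ℕ) (hm : 2 * m ≤ n) (p : MvPolynomial (Fin n × Fin n) ℂ)
    (hp : ∀ σ τ : Equiv.Perm (Fin n), rename (fun ij : Fin n × Fin n => (σ ij.1, τ ij.2)) p = p)
    (hdi : p ∈ Submodule.span ℂ {q : MvPolynomial (Fin n × Fin n) ℂ | ∃ (a : ℕ) (E : Multiset (Fin a × Fin a)),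
      a ≤ m ∧ q = ∑ h : Fin a → Fin n,
        (E.map fun e => (X (h e.1, h e.2) : MvPolynomial (Fin n × Fin n) ℂ)).prod}) :
    p ∈ Submodule.span ℂ {q : MvPolynomial (Fin n × Fin n) ℂ | ∃ (a b : ℕ) (F : Multiset (Fin a × Fin b)),
      treewidth (SimpleGraph.fromRel fun u v : Fin a ⊕ Fin b =>
          ∃ e ∈ F, u = Sum.inl e.1 ∧ v = Sum.inr e.2) ≤ m - 1 ∧
        q = homPoly F n ℂ} := by
  refine descent_of_vertexBudget n m (m - 1) hm p hp (Submodule.span_mono ?_ hdi)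
  rintro q ⟨a, D, ha, rfl⟩
  refine ⟨a, D, ha, ?_, rfl⟩
  refine (Literature.Combinatorics.SimpleGraph.treewidth_le_card_sub_one _).trans ?_
  rw [Fintype.card_fin]
  omega

end Summit.ValiantsHypothesis.ValiantsHypothesis.Theorems.SubThresholdDescent

end
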